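import Literature.NumberTheory.LFunctions.Zhang2022.DetectorShiftBulkSymbol
import Literature.Analysis.Fourier.HalfPeriodParseval

/-!
# Zhang (2022), programme F-S3 (cell landau-siegel §E, E-102 head 2, PARSEVAL-C2 pieces P2 + P3): the bulk form of
# formula I is DIAGONAL on the integer Fourier lattice of period 2 — `Re Q_b(g,g) = (π²/2)·Σ_ξ (p_b(ξ)/ξ²)·|ĝ(ξ)|²` on
# the clamped one-sided class — hence `SignAdmissible b → Det.BulkNonneg b` GIVEN the half-interval Parseval identity

Y. Zhang, *Discrete mean estimates and the Landau–Siegel zero*, arXiv:2211.02515v1 [Zhang2022LandauSiegel] —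
an unrefereed manuscript under adjudication. **WHAT THIS IS NOT: not a claim about Theorems 1–2 of
arXiv:2211.02515, about Landau–Siegel zeros, about a repaired `Margin232`, or about Parity; nothing here asserts the
row E-102 (`Det.EdetPremise`), its head 2 `Det.MonomialConePSD`, or `Det.FormDetPSD` of any recipe. The programme
SEARCHES and TYPES; no claim about Landau–Siegel zeros, Theorems 1–2 of arXiv:2211.02515 or a repaired Margin232
until a kernel theorem says so.**

CONTEXT. `DetectorShiftBulkSymbol` (ls-Bdet-typer-2 g2, p482386) typed SHIFT-PSD's bulk symbol
`p_b(x) = x(x+b₀)(x+b₁)(x+b₂)` (`Det.bulkSymbol`), proved `SignAdmissible b → ∀ k : ℤ, 0 ≤ p_b(k)`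
(`SignAdmissible.bulkSymbol_intCast_nonneg`), rewrote `Re Q_e(g,g)` (`Det.shiftCore`, the collapsed bulk form of
formula I, `DetectorRecipeCollapse` p479377) as four profile pairings (`re_shiftCore_self`), and NAMED the target
`Det.BulkNonneg b` («`Re Q_b(g,g) ≥ 0` for every one-sided kinked `g` clamped at both ends with mean zero»; SHIFT-PSD's
condition (C2); parametrised, asserted for no `b`). The desk claim PARSEVAL-C2 (ls-Bdet-typer-2 g2 2026-08-27T01:16Z,
theory referee PASS at paper level 01:21:21Z) is that (C2) is STRUCTURAL: Parseval on `[0,1] ⊂` (circle of length 2)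
diagonalises the constant-coefficient form. THIS FILE proves the g-variable form of that computation:

* Part 1 — the profile transform `ĝ(x) = ∫₀¹ g(y)e^{−iπxy} dy` (`Det.ghat`; body identical to the half-interval
  Parseval leaf's `halfHat`) and the characters `e^{iπξy}` as kinked profiles (`Det.chi`);
* Part 2 (P2, ONE integration by parts each, via the tree's `Det.integral_deriv_mul_conj_add`) — for kinked `g` with
  `g(0) = g(1) = 0`: `ĝ′(ξ) = iπξ·ĝ(ξ)` (`ghat_deriv`); if moreover `∫₀¹ g = 0` then, with `S_g(x) = ∫₀ˣ g`,
  `ĝ(ξ) = iπξ·Ŝ_g(ξ)` (`ghat_eq_prim`) and `ĝ(0) = 0`;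
* Part 3 (P3) — with the polarised half-period Parseval identity of `Literature.Analysis.Fourier.HalfPeriodParseval`
  (ls-Bdet-typer-1 g3, p483511: `Σ_ξ û(ξ)·conj v̂(ξ) = 2∫₀¹ u·conj v`), put into the profile class's `MemLp` shape
  by `hasSum_ghat_mul_conj`: `HasSum (ξ ↦ (π²/2)(ξ² + e₁ξ + e₂ + e₃/ξ)|ĝ(ξ)|²) (Re Q_e(g,g))` for ALL real
  `e₁ e₂ e₃` on the clamped class (`hasSum_re_shiftCore_self`), the `bulkSymbol` form, and
  **`bulkNonneg_of_signAdmissible : SignAdmissible b → BulkNonneg b`** UNCONDITIONALLY (termwise sign: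
  `p_b(ξ)/ξ² ≥ 0` on `ℤ`, the `ξ = 0` term vanishing because `ĝ(0) = ∫g = 0`);
* Part 4 — sanity: at the printed triple `(1,2,3)` the lattice weights are `p(ξ)/ξ² = (ξ+1)(ξ+2)(ξ+3)/ξ`, and
  `p(k−1) = (k−1)k(k+1)(k+2)` is O15's eigenvalue pattern (`MainTermFormPSD`).

Elementary real analysis (FTC / integration by parts on `[0,1]`, absolutely convergent series); standard axioms;
0 named facts. Cell landau-siegel, ls-Bmulti-typer-2 g3 (ls-barrier-plan g1 SPLIT OF RECORD 2026-08-27T01:20:18Z: P2+P3).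

References: Y. Zhang, arXiv:2211.02515v1 (2022), Prop. 7.1 p.44 with (7.2), §8 (8.11)–(8.23) [pp. 44–50];
barrier/num/SHIFT-PSD.md (ls-barrier-num, cell-internal) §0–§2; Y. Katznelson, *An introduction to harmonic
analysis*, 3rd ed. (2004), Ch. I §5.5 (Parseval) [Katznelson2004, via `HalfPeriodParseval`].
[cite: Zhang2022LandauSiegel, Prop 7.1 p.44 with (7.2), (8.11)–(8.23)]
-/

noncomputable section

open Complex Real Set intervalIntegral Filter Topology
open _root_.MeasureTheory
open scoped ComplexConjugate

namespace Literature.NumberTheory.LFunctions.Zhang2022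

open Repair

namespace Det

variable {g g' : ℝ → ℂ} {b : Fin 3 → ℝ}

/-! ### Part 1 — the profile transform and the characters -/

/-- **The profile transform** `ĝ(x) = ∫₀¹ g(y)·e^{−iπxy} dy` (half-interval Fourier coefficient at frequency `x` for
period 2; same body as `halfHat` of the half-interval Parseval leaf). [cite: Zhang2022LandauSiegel, Prop 7.1 p.44 with (7.2), (8.11)–(8.23)] -/
def ghat (u : ℝ → ℂ) (x : ℝ) : ℂ := ∫ y in (0:ℝ)..1, u y * cexp (-(I * π * x * y))

/-- Unfolding `ghat`. [cite: Zhang2022LandauSiegel, Prop 7.1 p.44 with (7.2), (8.11)–(8.23)] -/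
theorem ghat_def (u : ℝ → ℂ) (x : ℝ) : ghat u x = ∫ y in (0:ℝ)..1, u y * cexp (-(I * π * x * y)) := rfl

/-- `ĝ(0) = ∫₀¹ g`. [cite: Zhang2022LandauSiegel, Prop 7.1 p.44 with (7.2), (8.11)–(8.23)] -/
theorem ghat_zero (u : ℝ → ℂ) : ghat u 0 = ∫ y in (0:ℝ)..1, u y := by
  simp [ghat]

/-- The character `χ_ξ(y) = e^{iπξy}`. [cite: Zhang2022LandauSiegel, Prop 7.1 p.44 with (7.2), (8.11)–(8.23)] -/
def chi (ξ : ℝ) : ℝ → ℂ := fun y => cexp (I * π * ξ * y)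

/-- Its derivative `χ_ξ′(y) = iπξ·e^{iπξy}`. [cite: Zhang2022LandauSiegel, Prop 7.1 p.44 with (7.2), (8.11)–(8.23)] -/
def chi' (ξ : ℝ) : ℝ → ℂ := fun y => I * π * ξ * cexp (I * π * ξ * y)

/-- `conj χ_ξ(y) = e^{−iπξy}`. [cite: Zhang2022LandauSiegel, Prop 7.1 p.44 with (7.2), (8.11)–(8.23)] -/
theorem conj_chi (ξ y : ℝ) : conj (chi ξ y) = cexp (-(I * π * ξ * y)) := by
  rw [chi, ← Complex.exp_conj]
  congr 1
  simp only [map_mul, Complex.conj_I, Complex.conj_ofReal]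
  ring

/-- `conj χ_ξ′(y) = −iπξ·e^{−iπξy}`. [cite: Zhang2022LandauSiegel, Prop 7.1 p.44 with (7.2), (8.11)–(8.23)] -/
theorem conj_chi' (ξ y : ℝ) : conj (chi' ξ y) = -(I * π * ξ) * cexp (-(I * π * ξ * y)) := by
  have h := conj_chi ξ y
  rw [chi] at h
  simp only [chi', map_mul, Complex.conj_I, Complex.conj_ofReal, h]
  ring

/-- `χ_ξ` has derivative `χ_ξ′`. [cite: Zhang2022LandauSiegel, Prop 7.1 p.44 with (7.2), (8.11)–(8.23)] -/
theorem hasDerivAt_chi (ξ y : ℝ) : HasDerivAt (chi ξ) (chi' ξ y) y := by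
  have hlin : HasDerivAt (fun y : ℝ => I * π * ξ * (y : ℂ)) (I * π * ξ * 1) y := by
    exact ((hasDerivAt_id y).ofReal_comp).const_mul (I * π * ξ)
  have := hlin.cexp
  simp only [mul_one] at this
  refine this.congr_deriv ?_
  simp only [chi']
  ring

/-- A function continuous on `[0,1]` is square-integrable on `(0,1]`. [cite: Zhang2022LandauSiegel, Prop 7.1 p.44 with (7.2), (8.11)–(8.23)] -/
theorem memLp_two_of_continuousOn {u : ℝ → ℂ} (hu : ContinuousOn u (Icc (0:ℝ) 1)) :
    MemLp u 2 (volume.restrict (Ioc (0:ℝ) 1)) := by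
  obtain ⟨C, hC⟩ := isCompact_Icc.exists_bound_of_continuousOn hu
  refine MemLp.of_bound ((hu.mono Ioc_subset_Icc_self).aestronglyMeasurable measurableSet_Ioc) C ?_
  filter_upwards [ae_restrict_mem measurableSet_Ioc] with y hy
  exact hC y (Ioc_subset_Icc_self hy)

/-- The characters are kinked profiles. [cite: Zhang2022LandauSiegel, Prop 7.1 p.44 with (7.2), (8.11)–(8.23)] -/
theorem kinkedProfile_chi (ξ : ℝ) : KinkedProfile (chi ξ) (chi' ξ) where
  cont := by
    have : Continuous (chi ξ) := by unfold chi; fun_prop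
    exact this.continuousOn
  hasDeriv := fun y _ => (hasDerivAt_chi ξ y).hasDerivWithinAt
  memLp := by
    have : Continuous (chi' ξ) := by unfold chi'; fun_prop
    exact memLp_two_of_continuousOn this.continuousOn

/-! ### Part 2 — P2: the derivative and the primitive on the transform side (one integration by parts each) -/

/-- **`ĝ′(ξ) = iπξ·ĝ(ξ)`** for a kinked profile with `g(0) = g(1) = 0` (any real frequency `ξ`).
[cite: Zhang2022LandauSiegel, Prop 7.1 p.44 with (7.2), (8.11)–(8.23)] -/
theorem ghat_deriv (hg : KinkedProfile g g') (h0 : g 0 = 0) (h1 : g 1 = 0) (ξ : ℝ) :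
    ghat g' ξ = I * π * ξ * ghat g ξ := by
  have key := integral_deriv_mul_conj_add hg (kinkedProfile_chi ξ)
  rw [h0, h1, zero_mul, zero_mul, sub_zero] at key
  have e1 : (∫ x in (0:ℝ)..1, g' x * conj (chi ξ x)) = ghat g' ξ := by
    rw [ghat]
    refine intervalIntegral.integral_congr fun x _ => ?_
    simp only [conj_chi]
  have e2 : (∫ x in (0:ℝ)..1, g x * conj (chi' ξ x)) = -(I * π * ξ) * ghat g ξ := by
    rw [ghat, ← intervalIntegral.integral_const_mul]
    refine intervalIntegral.integral_congr fun x _ => ?_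
    simp only [conj_chi']
    ring
  rw [e1, e2] at key
  linear_combination key

/-- The primitive `S_g(x) = ∫₀ˣ g` of a kinked profile is a kinked profile with derivative `g`.
[cite: Zhang2022LandauSiegel, Prop 7.1 p.44 with (7.2), (8.11)–(8.23)] -/
theorem kinkedProfile_prim (hg : KinkedProfile g g') :
    KinkedProfile (fun x => ∫ t in (0:ℝ)..x, g t) g where
  cont := by
    have hint : IntervalIntegrable g volume 0 1 :=
      (hg.cont.mono (by rw [uIcc_of_le zero_le_one])).intervalIntegrable
    have := intervalIntegral.continuousOn_primitive_interval' hint (by simp : (0:ℝ) ∈ uIcc (0:ℝ) 1)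
    rwa [uIcc_of_le zero_le_one] at this
  hasDeriv := by
    intro x hx
    have hint : IntervalIntegrable g volume 0 x :=
      (hg.cont.mono (by
        rw [uIcc_of_le hx.1.le]; exact Icc_subset_Icc_right hx.2.le)).intervalIntegrable
    have hopen : IsOpen (Ioo (0:ℝ) 1) := isOpen_Ioo
    have hcont : ContinuousOn g (Ioo (0:ℝ) 1) := hg.cont.mono Ioo_subset_Icc_self
    have hmeas : StronglyMeasurableAtFilter g (𝓝 x) volume := hcont.stronglyMeasurableAtFilter hopen x hx
    have hcx : ContinuousAt g x := hcont.continuousAt (hopen.mem_nhds hx)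
    exact (intervalIntegral.integral_hasDerivAt_right hint hmeas hcx).hasDerivWithinAt
  memLp := memLp_two_of_continuousOn hg.cont

/-- **`ĝ(ξ) = iπξ·Ŝ_g(ξ)`**, `S_g(x) = ∫₀ˣ g`, for a kinked profile with `∫₀¹ g = 0` (any real `ξ`).
[cite: Zhang2022LandauSiegel, Prop 7.1 p.44 with (7.2), (8.11)–(8.23)] -/
theorem ghat_eq_prim (hg : KinkedProfile g g') (hI : (∫ x in (0:ℝ)..1, g x) = 0) (ξ : ℝ) :
    ghat g ξ = I * π * ξ * ghat (fun x => ∫ t in (0:ℝ)..x, g t) ξ :=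
  ghat_deriv (kinkedProfile_prim hg) (by simp) (by simpa using hI) ξ

/-- On the mean-zero class `ĝ(0) = 0`. [cite: Zhang2022LandauSiegel, Prop 7.1 p.44 with (7.2), (8.11)–(8.23)] -/
theorem ghat_zero_of_integral_zero {u : ℝ → ℂ} (hI : (∫ x in (0:ℝ)..1, u x) = 0) : ghat u 0 = 0 := by
  rw [ghat_zero, hI]

/-! ### Part 3 — P3: the lattice diagonalisation of the bulk form, GIVEN the half-interval Parseval identity -/

/-! #### The half-period Parseval identity in the `MemLp` hypothesis shape
P1 of record = `Literature.Analysis.Fourier.hasSum_hpCoeff_mul_conj` (`HalfPeriodParseval`, ls-Bdet-typer-1 g3,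
p483511; [Katznelson2004, Ch. I §5.5]) is stated for `Measurable u` on `ℝ` with `‖u‖²` interval-integrable; the
profile class hands `MemLp _ 2 (volume.restrict (Ioc 0 1))` (e.g. `KinkedProfile.memLp` for `g′`). The bridge
below passes to strongly measurable representatives (the coefficients and the pairing only see `u` a.e. on
`(0,1]`) and identifies `hpCoeff u ξ = ghat u ξ`. (ls-Bdet-num-1 g4's P1-v2 append will carry the same wrappers in
the Fourier leaf's own vocabulary; this private copy keeps P3 unconditional now.) -/

/-- `hpKer ξ y = e^{−iπξy}` in this file's spelling. [cite: Zhang2022LandauSiegel, Prop 7.1 p.44 with (7.2), (8.11)–(8.23)] -/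
theorem hpKer_eq (ξ : ℤ) (y : ℝ) :
    Literature.Analysis.Fourier.hpKer ξ y = cexp (-(I * π * ((ξ : ℝ) : ℂ) * y)) := by
  rw [Literature.Analysis.Fourier.hpKer]
  push_cast
  ring_nf

/-- `hpCoeff u ξ = ghat u ξ` at integer frequencies. [cite: Zhang2022LandauSiegel, Prop 7.1 p.44 with (7.2), (8.11)–(8.23)] -/
theorem hpCoeff_eq_ghat (u : ℝ → ℂ) (ξ : ℤ) : Literature.Analysis.Fourier.hpCoeff u ξ = ghat u ξ := by
  rw [Literature.Analysis.Fourier.hpCoeff, ghat]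
  refine intervalIntegral.integral_congr fun y _ => ?_
  simp only [hpKer_eq]

/-- An a.e.-modification on `(0,1]` does not change `ghat`. [cite: Zhang2022LandauSiegel, Prop 7.1 p.44 with (7.2), (8.11)–(8.23)] -/
theorem ghat_congr_ae {u U : ℝ → ℂ} (h : u =ᵐ[volume.restrict (Ioc (0:ℝ) 1)] U) (ξ : ℝ) :
    ghat u ξ = ghat U ξ := by
  rw [ghat, ghat]
  refine intervalIntegral.integral_congr_ae ?_
  have h' := (ae_restrict_iff' (measurableSet_Ioc : MeasurableSet (Ioc (0:ℝ) 1))).1 h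
  filter_upwards [h'] with y hy hmem
  rw [uIoc_of_le zero_le_one] at hmem
  rw [hy hmem]

/-- **P1 in the `MemLp` shape**: `Σ_ξ û(ξ)·conj v̂(ξ) = 2∫₀¹ u·conj v` for `u, v` square-integrable on `(0,1]`
(from `Literature.Analysis.Fourier.hasSum_hpCoeff_mul_conj` via measurable representatives).
[cite: Zhang2022LandauSiegel, Prop 7.1 p.44 with (7.2), (8.11)–(8.23)] -/
theorem hasSum_ghat_mul_conj {u v : ℝ → ℂ} (hu : MemLp u 2 (volume.restrict (Ioc (0:ℝ) 1)))
    (hv : MemLp v 2 (volume.restrict (Ioc (0:ℝ) 1))) :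
    HasSum (fun ξ : ℤ => ghat u ξ * conj (ghat v ξ)) (2 * ∫ y in (0:ℝ)..1, u y * conj (v y)) := by
  -- strongly measurable representatives
  have hU : u =ᵐ[volume.restrict (Ioc (0:ℝ) 1)] hu.1.mk u := hu.1.ae_eq_mk
  have hV : v =ᵐ[volume.restrict (Ioc (0:ℝ) 1)] hv.1.mk v := hv.1.ae_eq_mk
  have mU : Measurable (hu.1.mk u) := hu.1.stronglyMeasurable_mk.measurable
  have mV : Measurable (hv.1.mk v) := hv.1.stronglyMeasurable_mk.measurable
  have sq : ∀ {w W : ℝ → ℂ}, MemLp w 2 (volume.restrict (Ioc (0:ℝ) 1)) →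
      w =ᵐ[volume.restrict (Ioc (0:ℝ) 1)] W → IntervalIntegrable (fun x => ‖W x‖ ^ 2) volume 0 1 := by
    intro w W hw hwW
    have hW : MemLp W 2 (volume.restrict (Ioc (0:ℝ) 1)) := hw.ae_eq hwW
    have hint : Integrable (fun x => ‖W x‖ ^ 2) (volume.restrict (Ioc (0:ℝ) 1)) :=
      (memLp_two_iff_integrable_sq_norm hW.1).1 hW
    exact (intervalIntegrable_iff_integrableOn_Ioc_of_le zero_le_one).2 hint
  have key := Literature.Analysis.Fourier.hasSum_hpCoeff_mul_conj mU mV (sq hu hU) (sq hv hV)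
  -- transport back along the a.e. equalities
  have e1 : ∀ ξ : ℤ, Literature.Analysis.Fourier.hpCoeff (hu.1.mk u) ξ = ghat u ξ := fun ξ => by
    rw [hpCoeff_eq_ghat, ← ghat_congr_ae hU]
  have e2 : ∀ ξ : ℤ, Literature.Analysis.Fourier.hpCoeff (hv.1.mk v) ξ = ghat v ξ := fun ξ => by
    rw [hpCoeff_eq_ghat, ← ghat_congr_ae hV]
  have e3 : (∫ x in (0:ℝ)..1, hu.1.mk u x * conj (hv.1.mk v x)) = ∫ y in (0:ℝ)..1, u y * conj (v y) := by
    refine intervalIntegral.integral_congr_ae ?_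
    have hU' := (ae_restrict_iff' (measurableSet_Ioc : MeasurableSet (Ioc (0:ℝ) 1))).1 hU
    have hV' := (ae_restrict_iff' (measurableSet_Ioc : MeasurableSet (Ioc (0:ℝ) 1))).1 hV
    filter_upwards [hU', hV'] with y hyu hyv hmem
    rw [uIoc_of_le zero_le_one] at hmem
    rw [hyu hmem, hyv hmem]
  simp only [e1, e2, e3] at key
  exact key

/-- The summands `π²ξ²|ĝ(ξ)|²`, `−iπξ|ĝ(ξ)|²`, `|ĝ(ξ)|²`, `i|ĝ(ξ)|²/(πξ)` of the four pairings. Pointwise algebra on the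
transform side. [cite: Zhang2022LandauSiegel, Prop 7.1 p.44 with (7.2), (8.11)–(8.23)] -/
private theorem pairing_terms (hg : KinkedProfile g g') (h0 : g 0 = 0) (h1 : g 1 = 0)
    (hI : (∫ x in (0:ℝ)..1, g x) = 0) (ξ : ℤ) :
    ghat g' ξ * conj (ghat g' ξ) = (((π ^ 2 * (ξ : ℝ) ^ 2 * ‖ghat g ξ‖ ^ 2 : ℝ)) : ℂ)
    ∧ ghat g ξ * conj (ghat g' ξ) = I * (((-(π * ξ * ‖ghat g ξ‖ ^ 2) : ℝ)) : ℂ)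
    ∧ ghat g ξ * conj (ghat g ξ) = (((‖ghat g ξ‖ ^ 2 : ℝ)) : ℂ)
    ∧ ghat g ξ * conj (ghat (fun x => ∫ t in (0:ℝ)..x, g t) ξ)
        = I * (((‖ghat g ξ‖ ^ 2 / (π * ξ) : ℝ)) : ℂ) := by
  have hsq : ghat g ξ * conj (ghat g ξ) = (((‖ghat g ξ‖ ^ 2 : ℝ)) : ℂ) := by
    rw [Complex.mul_conj', Complex.ofReal_pow]
  -- `ĝ′ = iπξ ĝ` with the integer cast normalised
  have hd : ghat g' ξ = I * π * (ξ : ℂ) * ghat g ξ := by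
    have := ghat_deriv hg h0 h1 ξ
    rw [Complex.ofReal_intCast] at this
    exact this
  have hc : conj (I * π * (ξ : ℂ)) = -(I * π * (ξ : ℂ)) := by
    simp only [map_mul, Complex.conj_I, Complex.conj_ofReal, map_intCast]; ring
  refine ⟨?_, ?_, hsq, ?_⟩
  · rw [hd, map_mul, hc]
    have e : I * ↑π * (ξ : ℂ) * ghat g ξ * (-(I * ↑π * (ξ : ℂ)) * conj (ghat g ξ))
        = -(I * I) * (π ^ 2 * (ξ : ℂ) ^ 2) * (ghat g ξ * conj (ghat g ξ)) := by ring
    rw [e, hsq, Complex.I_mul_I]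
    push_cast
    ring
  · rw [hd, map_mul, hc]
    have e : ghat g ξ * (-(I * ↑π * (ξ : ℂ)) * conj (ghat g ξ)) = -(I * π * (ξ : ℂ)) * (ghat g ξ * conj (ghat g ξ)) := by
      ring
    rw [e, hsq]
    push_cast
    ring
  · -- the primitive pairing
    by_cases hξ : ξ = 0
    · subst hξ
      simp [ghat_zero_of_integral_zero hI]
    · have hne : (I * π * (ξ : ℂ)) ≠ 0 := by
        have hξ' : (ξ : ℂ) ≠ 0 := by exact_mod_cast hξ
        have hπ : (π : ℂ) ≠ 0 := by exact_mod_cast Real.pi_ne_zero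
        exact mul_ne_zero (mul_ne_zero Complex.I_ne_zero hπ) hξ'
      have hp : ghat g ξ = I * π * (ξ : ℂ) * ghat (fun x => ∫ t in (0:ℝ)..x, g t) ξ := by
        have := ghat_eq_prim hg hI ξ
        rw [Complex.ofReal_intCast] at this
        exact this
      have hS : ghat (fun x => ∫ t in (0:ℝ)..x, g t) ξ = ghat g ξ / (I * π * (ξ : ℂ)) := by
        rw [eq_div_iff hne, mul_comm]; exact hp.symm
      rw [hS, map_div₀, hc, mul_div_assoc', hsq]
      have hξ' : (ξ : ℂ) ≠ 0 := by exact_mod_cast hξ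
      have hπ : (π : ℂ) ≠ 0 := by exact_mod_cast Real.pi_ne_zero
      push_cast
      field_simp
      rw [Complex.I_sq]
      ring

/-- **P3 — the lattice diagonalisation of the bulk form.** For every real `e₁ e₂ e₃` and every kinked profile `g`
clamped at both ends (`g(0) = g(1) = 0`) with mean zero:
`HasSum (ξ ↦ (π²/2)·(ξ² + e₁ξ + e₂ + e₃/ξ)·|ĝ(ξ)|²) (Re Q_e(g,g))` (the `ξ = 0` summand is `0` since `ĝ(0) = 0`;
Lean's `e₃/0 = 0`). [cite: Zhang2022LandauSiegel, Prop 7.1 p.44 with (7.2), (8.11)–(8.23)] -/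
theorem hasSum_re_shiftCore_self
    (e1 e2 e3 : ℝ) (hg : KinkedProfile g g') (h1 : g 1 = 0) (h0 : g 0 = 0)
    (hI : (∫ x in (0:ℝ)..1, g x) = 0) :
    HasSum (fun ξ : ℤ => π ^ 2 / 2 * (((ξ : ℝ) ^ 2 + e1 * ξ + e2 + e3 / ξ) * ‖ghat g ξ‖ ^ 2))
      (shiftCore e1 e2 e3 g g' g g').re := by
  -- the four Parseval sums
  have mg : MemLp g 2 (volume.restrict (Ioc (0:ℝ) 1)) := memLp_two_of_continuousOn hg.cont
  have mg' : MemLp g' 2 (volume.restrict (Ioc (0:ℝ) 1)) := hg.memLp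
  have mS : MemLp (fun x => ∫ t in (0:ℝ)..x, g t) 2 (volume.restrict (Ioc (0:ℝ) 1)) :=
    memLp_two_of_continuousOn (kinkedProfile_prim hg).cont
  have hA := hasSum_ghat_mul_conj mg' mg'
  have hB := hasSum_ghat_mul_conj mg mg'
  have hC := hasSum_ghat_mul_conj mg mg
  have hD := hasSum_ghat_mul_conj mg mS
  -- rewrite the summands on the transform side
  have tA : (fun ξ : ℤ => ghat g' ξ * conj (ghat g' ξ))
      = fun ξ : ℤ => (((π ^ 2 * (ξ : ℝ) ^ 2 * ‖ghat g ξ‖ ^ 2 : ℝ)) : ℂ) :=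
    funext fun ξ => (pairing_terms hg h0 h1 hI ξ).1
  have tB : (fun ξ : ℤ => ghat g ξ * conj (ghat g' ξ))
      = fun ξ : ℤ => I * (((-(π * ξ * ‖ghat g ξ‖ ^ 2) : ℝ)) : ℂ) :=
    funext fun ξ => (pairing_terms hg h0 h1 hI ξ).2.1
  have tC : (fun ξ : ℤ => ghat g ξ * conj (ghat g ξ)) = fun ξ : ℤ => (((‖ghat g ξ‖ ^ 2 : ℝ)) : ℂ) :=
    funext fun ξ => (pairing_terms hg h0 h1 hI ξ).2.2.1
  have tD : (fun ξ : ℤ => ghat g ξ * conj (ghat (fun x => ∫ t in (0:ℝ)..x, g t) ξ))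
      = fun ξ : ℤ => I * (((‖ghat g ξ‖ ^ 2 / (π * ξ) : ℝ)) : ℂ) :=
    funext fun ξ => (pairing_terms hg h0 h1 hI ξ).2.2.2
  rw [tA] at hA; rw [tB] at hB; rw [tC] at hC; rw [tD] at hD
  -- real and imaginary parts (values kept as `(2 * ∫ …).re/.im`)
  have rA : HasSum (fun ξ : ℤ => π ^ 2 * (ξ : ℝ) ^ 2 * ‖ghat g ξ‖ ^ 2)
      (2 * ∫ y in (0:ℝ)..1, g' y * conj (g' y)).re := by
    have := Complex.hasSum_re hA
    simpa only [Complex.ofReal_re] using this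
  have iB : HasSum (fun ξ : ℤ => -(π * ξ * ‖ghat g ξ‖ ^ 2))
      (2 * ∫ y in (0:ℝ)..1, g y * conj (g' y)).im := by
    have := Complex.hasSum_im hB
    simpa only [Complex.I_mul_im, Complex.ofReal_re] using this
  have rC : HasSum (fun ξ : ℤ => ‖ghat g ξ‖ ^ 2) (2 * ∫ y in (0:ℝ)..1, g y * conj (g y)).re := by
    have := Complex.hasSum_re hC
    simpa only [Complex.ofReal_re] using this
  have iD : HasSum (fun ξ : ℤ => ‖ghat g ξ‖ ^ 2 / (π * ξ))
      (2 * ∫ y in (0:ℝ)..1, g y * conj (∫ t in (0:ℝ)..y, g t)).im := by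
    have := Complex.hasSum_im hD
    simpa only [Complex.I_mul_im, Complex.ofReal_re] using this
  have goal := ((rA.mul_left (1 / 2 : ℝ)).add ((iB.mul_left (-(π * e1) / 2)).add
    ((rC.mul_left (π ^ 2 * e2 / 2)).add (iD.mul_left (π ^ 3 * e3 / 2)))))
  -- pointwise: the combined summand is the displayed one
  have hfun : (fun ξ : ℤ => 1 / 2 * (π ^ 2 * (ξ : ℝ) ^ 2 * ‖ghat g ξ‖ ^ 2)
      + (-(π * e1) / 2 * -(π * ξ * ‖ghat g ξ‖ ^ 2)
        + (π ^ 2 * e2 / 2 * ‖ghat g ξ‖ ^ 2 + π ^ 3 * e3 / 2 * (‖ghat g ξ‖ ^ 2 / (π * ξ)))))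
      = fun ξ : ℤ => π ^ 2 / 2 * (((ξ : ℝ) ^ 2 + e1 * ξ + e2 + e3 / ξ) * ‖ghat g ξ‖ ^ 2) := by
    funext ξ
    by_cases hξ : ξ = 0
    · subst hξ; simp [ghat_zero_of_integral_zero hI]
    · have hξ' : (ξ : ℝ) ≠ 0 := by exact_mod_cast hξ
      field_simp
      ring
  -- the value: the four-pairing formula for `Re Q` (`re_shiftCore_self`)
  have hval : 1 / 2 * (2 * ∫ y in (0:ℝ)..1, g' y * conj (g' y)).re
      + (-(π * e1) / 2 * (2 * ∫ y in (0:ℝ)..1, g y * conj (g' y)).im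
        + (π ^ 2 * e2 / 2 * (2 * ∫ y in (0:ℝ)..1, g y * conj (g y)).re
          + π ^ 3 * e3 / 2 * (2 * ∫ y in (0:ℝ)..1, g y * conj (∫ t in (0:ℝ)..y, g t)).im))
      = (shiftCore e1 e2 e3 g g' g g').re := by
    rw [re_shiftCore_self, hI]
    simp only [map_zero, mul_zero, zero_mul, zero_sub, sub_zero, add_zero, Complex.neg_im, Complex.mul_re,
      Complex.mul_im, Complex.re_ofNat, Complex.im_ofNat]
    ring
  rw [hfun, hval] at goal
  exact goal

/-- **P3, `tsum` form**: `Re Q_e(g,g) = (π²/2)·Σ_ξ (ξ² + e₁ξ + e₂ + e₃/ξ)·|ĝ(ξ)|²` on the clamped mean-zero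
class. [cite: Zhang2022LandauSiegel, Prop 7.1 p.44 with (7.2), (8.11)–(8.23)] -/
theorem re_shiftCore_self_eq_tsum
    (e1 e2 e3 : ℝ) (hg : KinkedProfile g g') (h1 : g 1 = 0) (h0 : g 0 = 0)
    (hI : (∫ x in (0:ℝ)..1, g x) = 0) :
    (shiftCore e1 e2 e3 g g' g g').re
      = ∑' ξ : ℤ, π ^ 2 / 2 * (((ξ : ℝ) ^ 2 + e1 * ξ + e2 + e3 / ξ) * ‖ghat g ξ‖ ^ 2) :=
  (hasSum_re_shiftCore_self e1 e2 e3 hg h1 h0 hI).tsum_eq.symm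

/-- The bulk symbol in the elementary symmetric functions: `p_b(x) = x⁴ + e₁x³ + e₂x² + e₃x`.
[cite: Zhang2022LandauSiegel, Prop 7.1 p.44 with (7.2), (8.11)–(8.23)] -/
theorem bulkSymbol_eq_sym (b : Fin 3 → ℝ) (x : ℝ) :
    bulkSymbol b x = x ^ 4 + symE1 b * x ^ 3 + symE2 b * x ^ 2 + symE3 b * x := by
  simp only [bulkSymbol, symE1, symE2, symE3]
  ring

/-- For `ξ ≠ 0`: `p_b(ξ)/ξ² = ξ² + e₁ξ + e₂ + e₃/ξ`. [cite: Zhang2022LandauSiegel, Prop 7.1 p.44 with (7.2), (8.11)–(8.23)] -/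
theorem bulkSymbol_div_sq (b : Fin 3 → ℝ) {x : ℝ} (hx : x ≠ 0) :
    bulkSymbol b x / x ^ 2 = x ^ 2 + symE1 b * x + symE2 b + symE3 b / x := by
  rw [bulkSymbol_eq_sym]
  field_simp

/-- **P3 for a shift triple**: `HasSum (ξ ↦ (π²/2)·(p_b(ξ)/ξ²)·|ĝ(ξ)|²) (Re Q_b(g,g))` on the clamped mean-zero
class. [cite: Zhang2022LandauSiegel, Prop 7.1 p.44 with (7.2), (8.11)–(8.23)] -/
theorem hasSum_re_shiftCore_self_bulkSymbol
    (b : Fin 3 → ℝ) (hg : KinkedProfile g g') (h1 : g 1 = 0) (h0 : g 0 = 0)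
    (hI : (∫ x in (0:ℝ)..1, g x) = 0) :
    HasSum (fun ξ : ℤ => π ^ 2 / 2 * (bulkSymbol b ξ / (ξ : ℝ) ^ 2 * ‖ghat g ξ‖ ^ 2))
      (shiftCore (symE1 b) (symE2 b) (symE3 b) g g' g g').re := by
  have h := hasSum_re_shiftCore_self (symE1 b) (symE2 b) (symE3 b) hg h1 h0 hI
  have hfun : (fun ξ : ℤ => π ^ 2 / 2 * (bulkSymbol b ξ / (ξ : ℝ) ^ 2 * ‖ghat g ξ‖ ^ 2))
      = fun ξ : ℤ => π ^ 2 / 2 * (((ξ : ℝ) ^ 2 + symE1 b * ξ + symE2 b + symE3 b / ξ) * ‖ghat g ξ‖ ^ 2) := by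
    funext ξ
    by_cases hξ : ξ = 0
    · subst hξ
      simp [ghat_zero_of_integral_zero hI]
    · rw [bulkSymbol_div_sq b (by exact_mod_cast hξ : (ξ : ℝ) ≠ 0)]
  rw [hfun]
  exact h

/-- **`SignAdmissible b → BulkNonneg b`** — SHIFT-PSD's bulk condition (C2) is STRUCTURAL on the whole
sign-admissible set: every lattice weight `p_b(ξ)/ξ²` is `≥ 0` (`SignAdmissible.bulkSymbol_intCast_nonneg`) and
the Parseval series has non-negative terms. Unconditional (P1 = `HalfPeriodParseval`, p483511).
[cite: Zhang2022LandauSiegel, Prop 7.1 p.44 with (7.2), (8.11)–(8.23)] -/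
theorem bulkNonneg_of_signAdmissible (h : SignAdmissible b) : BulkNonneg b := by
  intro g g' hg h1 h0 hI
  refine (hasSum_re_shiftCore_self_bulkSymbol b hg h1 h0 hI).nonneg fun ξ => ?_
  have hp : 0 ≤ bulkSymbol b (ξ : ℝ) := h.bulkSymbol_intCast_nonneg ξ
  positivity

/-! ### Part 4 — sanity at the printed triple `(1,2,3)` -/

/-- At `b = (1,2,3)`: `p(ξ) = ξ(ξ+1)(ξ+2)(ξ+3)`, so `p(k−1) = (k−1)k(k+1)(k+2)` — O15's eigenvalue pattern
`π⁴(k−1)k(k+1)(k+2)` of `MainTermFormPSD`. [cite: Zhang2022LandauSiegel, Prop 7.1 p.44 with (7.2), (8.11)–(8.23)] -/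
theorem bulkSymbol_std_shift (k : ℝ) :
    bulkSymbol ![1, 2, 3] (k - 1) = (k - 1) * k * (k + 1) * (k + 2) := by
  simp [bulkSymbol]
  ring

end Det

end Literature.NumberTheory.LFunctions.Zhang2022
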